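import Literature.RepresentationTheory.FiniteGroups.TensorCoordinatesModP
import Literature.RepresentationTheory.FiniteGroups.InvariantsAdditivePrimeToP
import Literature.RepresentationTheory.FiniteGroups.RegularTensorInvariants
import Mathlib.Algebra.Module.ZMod
import HarnessLib

/-!
# Fixed vectors of matrix twists: coordinates, additivity, and the regular value

Topic `RepresentationTheory/FiniteGroups`; namespace
`Literature.RepresentationTheory.FiniteGroups.MatrixTwist`.  Definitions + theorems (no named fact,
no `sorry`, no instance).

For a finite group `Δ`, a prime `p` and an integer matrix family `a : Δ → Mat_d(ℤ)`, and for a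
`ℤ[Δ]`-module `τ` on `X`, the **fixed-vector count**

  `F_a(τ) := #{h : Fin d → X | ∀ c, (∑_j a(c) i j • τ(c) (h j))_i = h}`

is the number of `Δ`-invariants of the "matrix twist" of `τ` — the diagonal module `X ⊗ M′` written in
a basis of `M′` (`TensorCoordinatesModP`).  This file supplies, in the currency of the lane's (E):
* (E2a-1) **`coordMatrix σ bv`**, the integer lifts of the matrix coefficients of `σ : Δ → GL(M′)` in an
  `𝔽_p`-basis `bv` (`coordMatrix_spec`), with the unit / multiplicativity relations they satisfy on
  EVERY `p`-torsion module (`sum_coordMatrix_one`, `sum_coordMatrix_mul`: the action depends only on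
  `a mod p`);
* (E2a-2) **`additive_padicValNat_fixedVectors`**: for `p ∤ #Δ` and any `a` satisfying those relations,
  `ψ(τ) := v_p F_a(τ)` is additive on short exact sequences of finite `ℤ[Δ]`-modules killed by `p`
  (the `hψ` Π-type of the lane's additive calculus, instance-polymorphic) — via the twisted
  representation on `Fin d → X` and `InvariantsAdditivePrimeToP`;
* (E2a-3) **`natCard_fixedVectors_permQuot`**: `F_{coordMatrix σ bv}(ℤ[Δ]/p) = #M′`
  (`TensorCoordinatesModP` + `RegularTensorInvariants`).
Lane «TATE-EPC-TC» of cell `bsd-eis`, brick B8-alg (E2a), routed by -w7 g9.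

## References
* [MilneADT2006] J. S. Milne, *Arithmetic Duality Theorems*, I §5 (Lemma 5.4, proof of Thm. 5.1).
* [SerreLinearRepresentations1977] J.-P. Serre, *Linear Representations of Finite Groups*, §1.5
  (tensor products in coordinates), §14–§15 (reduction mod `p`).
-/

namespace Literature.RepresentationTheory.FiniteGroups

namespace MatrixTwist

open Function
open scoped Pointwise

variable {Δ : Type} [Group Δ] {p : ℕ} [Fact p.Prime] {d : ℕ}

/-! ### Scalars: integer lifts of residues on `p`-torsion modules -/

/-- On an `𝔽_p`-vector space the integer lift `x.val` acts as `x`.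
[cite: SerreLinearRepresentations1977, §14.1] -/
theorem natCast_val_zsmul {N : Type*} [AddCommGroup N] [Module (ZMod p) N] (x : ZMod p) (n : N) :
    ((x.val : ℤ)) • n = x • n := by
  rw [natCast_zsmul, ← Nat.cast_smul_eq_nsmul (ZMod p), ZMod.natCast_zmod_val]

/-- A `ℤ`-linear map between `𝔽_p`-vector spaces is `𝔽_p`-linear.
[cite: SerreLinearRepresentations1977, §14.1] -/
theorem map_zmod_smul {N N' : Type*} [AddCommGroup N] [Module (ZMod p) N] [AddCommGroup N']
    [Module (ZMod p) N'] (f : N →ₗ[ℤ] N') (x : ZMod p) (n : N) : f (x • n) = x • f n := by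
  rw [← natCast_val_zsmul, map_zsmul, natCast_val_zsmul]

omit [Fact p.Prime] in
/-- On a `p`-torsion group, integers with the same residue mod `p` act alike.
[cite: SerreLinearRepresentations1977, §14.1] -/
theorem zsmul_congr_of_intCast_eq {X : Type*} [AddCommGroup X] (hX : ∀ x : X, (p : ℤ) • x = 0)
    {m m' : ℤ} (h : (m : ZMod p) = (m' : ZMod p)) (x : X) : m • x = m' • x := by
  obtain ⟨k, hk⟩ := (ZMod.intCast_eq_intCast_iff_dvd_sub m m' p).mp h
  rw [show m' = m + p * k by rw [← hk]; ring, add_smul, mul_comm, mul_smul, hX, smul_zero, add_zero]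

/-! ### (E2a-1) Coordinates of `σ` in an `𝔽_p`-basis -/

section Coord

variable {M' : Type} [AddCommGroup M'] [Module (ZMod p) M'] (σ : Representation ℤ Δ M')
  (bv : Module.Basis (Fin d) (ZMod p) M')

/-- **Integer lifts of the matrix coefficients of `σ(c)` in the basis `bv`**:
`coordMatrix σ bv c i j = (bv.repr (σ c (bv j)) i).val`. [cite: SerreLinearRepresentations1977, §1.5] -/
noncomputable def coordMatrix : Δ → Matrix (Fin d) (Fin d) ℤ := fun c i j => ((bv.repr (σ c (bv j)) i).val : ℤ)

/-- The residue of `coordMatrix` is the genuine coefficient. [cite: SerreLinearRepresentations1977, §1.5] -/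
theorem intCast_coordMatrix (c : Δ) (i j : Fin d) :
    ((coordMatrix σ bv c i j : ℤ) : ZMod p) = bv.repr (σ c (bv j)) i := by
  rw [coordMatrix, Int.cast_natCast, ZMod.natCast_zmod_val]

/-- **`σ(c) bv_j = ∑_i coordMatrix σ bv c i j • bv_i`.** [cite: SerreLinearRepresentations1977, §1.5] -/
theorem coordMatrix_spec (c : Δ) (j : Fin d) : σ c (bv j) = ∑ i, coordMatrix σ bv c i j • bv i := by
  conv_lhs => rw [← bv.sum_repr (σ c (bv j))]
  exact Finset.sum_congr rfl fun i _ => (natCast_val_zsmul _ _).symm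

/-- `coordMatrix σ bv 1` is the identity matrix. [cite: SerreLinearRepresentations1977, §1.5] -/
theorem coordMatrix_one (i j : Fin d) : coordMatrix σ bv 1 i j = if i = j then 1 else 0 := by
  simp only [coordMatrix, map_one, Module.End.one_apply, Module.Basis.repr_self, Finsupp.single_apply]
  by_cases h : j = i
  · subst h; rw [if_pos rfl, if_pos rfl, ZMod.val_one, Nat.cast_one]
  · rw [if_neg h, if_neg (Ne.symm h), ZMod.val_zero, Nat.cast_zero]

/-- Residues multiply: `coordMatrix (c c') ≡ coordMatrix c · coordMatrix c' (mod p)`.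
[cite: SerreLinearRepresentations1977, §1.5] -/
theorem intCast_coordMatrix_mul (c c' : Δ) (i k : Fin d) :
    ((coordMatrix σ bv (c * c') i k : ℤ) : ZMod p) =
      ∑ j, ((coordMatrix σ bv c i j : ℤ) : ZMod p) * ((coordMatrix σ bv c' j k : ℤ) : ZMod p) := by
  simp_rw [intCast_coordMatrix]
  rw [map_mul, Module.End.mul_apply]
  conv_lhs => rw [← bv.sum_repr (σ c' (bv k)), map_sum, map_sum, Finsupp.finsetSum_apply]
  refine Finset.sum_congr rfl fun j _ => ?_
  rw [map_zmod_smul, map_smul, Finsupp.smul_apply, smul_eq_mul, mul_comm]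

/-- **Unit relation on every `p`-torsion module**: `∑_j coordMatrix σ bv 1 i j • x j = x i`.
[cite: SerreLinearRepresentations1977, §1.5] -/
theorem sum_coordMatrix_one {X : Type} [AddCommGroup X] [Module ℤ X] (x : Fin d → X) :
    (fun i => ∑ j, coordMatrix σ bv 1 i j • x j) = x := by
  rename_i instX
  cases Subsingleton.elim instX (AddCommGroup.toIntModule X)
  funext i
  simp_rw [coordMatrix_one, ite_smul, one_smul, zero_smul, Finset.sum_ite_eq, Finset.mem_univ, if_true]

/-- **Multiplicativity on every `p`-torsion module** (`pX = 0`): the action of `coordMatrix (c c')`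
is that of `coordMatrix c` after `coordMatrix c'` — the matrix action depends only on `a mod p`.
[cite: SerreLinearRepresentations1977, §1.5] -/
theorem sum_coordMatrix_mul {X : Type} [AddCommGroup X] [Module ℤ X] (hX : ∀ x : X, (p : ℤ) • x = 0)
    (c c' : Δ) (x : Fin d → X) :
    (fun i => ∑ j, coordMatrix σ bv (c * c') i j • x j) =
      fun i => ∑ j, coordMatrix σ bv c i j • ∑ k, coordMatrix σ bv c' j k • x k := by
  rename_i instX
  cases Subsingleton.elim instX (AddCommGroup.toIntModule X)
  funext i
  simp_rw [Finset.smul_sum, smul_smul]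
  rw [Finset.sum_comm]
  refine Finset.sum_congr rfl fun k _ => ?_
  rw [← Finset.sum_smul]
  refine zsmul_congr_of_intCast_eq hX ?_ (x k)
  rw [intCast_coordMatrix_mul, Int.cast_sum]
  simp_rw [Int.cast_mul]

end Coord

/-! ### (E2a-2) The matrix twist as a representation, and additivity of `v_p F_a` -/

section Twist

variable (a : Δ → Matrix (Fin d) (Fin d) ℤ)

/-- **The matrix twist of `τ` by `a`**: `Δ` acting on `Fin d → V` by
`(c • h) i = ∑_j a(c) i j • τ(c) (h j)` — a representation as soon as `a` satisfies the unit and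
multiplicativity relations on `V`. [cite: MilneADT2006, I §5 (proof of Thm. 5.1)]
[cite: SerreLinearRepresentations1977, §1.5] -/
def twistRep {V : Type} [AddCommGroup V] (τ : Representation ℤ Δ V)
    (h1 : ∀ x : Fin d → V, (fun i => ∑ j, a 1 i j • x j) = x)
    (hmul : ∀ (c c' : Δ) (x : Fin d → V),
      (fun i => ∑ j, a (c * c') i j • x j) = fun i => ∑ j, a c i j • ∑ k, a c' j k • x k) :
    Representation ℤ Δ (Fin d → V) where
  toFun c :=
    { toFun := fun h i => ∑ j, a c i j • τ c (h j)
      map_add' := fun h h' => funext fun i => by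
        simp only [Pi.add_apply, map_add, smul_add, Finset.sum_add_distrib]
      map_smul' := fun n h => funext fun i => by
        simp only [Pi.smul_apply, map_zsmul, RingHom.id_apply, Finset.smul_sum, smul_comm n] }
  map_one' := LinearMap.ext fun h => by
    change (fun i => ∑ j, a 1 i j • τ 1 (h j)) = h
    rw [map_one]
    exact h1 h
  map_mul' c c' := LinearMap.ext fun h => by
    change (fun i => ∑ j, a (c * c') i j • τ (c * c') (h j)) =
      fun i => ∑ j, a c i j • τ c (∑ k, a c' j k • τ c' (h k))
    rw [map_mul]
    simp_rw [Module.End.mul_apply, map_sum, map_zsmul]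
    exact hmul c c' fun k => τ c (τ c' (h k))

/-- Unfolding `twistRep`. [cite: MilneADT2006, I §5 (proof of Thm. 5.1)] -/
theorem twistRep_apply {V : Type} [AddCommGroup V] (τ : Representation ℤ Δ V) (h1) (hmul) (c : Δ)
    (h : Fin d → V) : twistRep a τ h1 hmul c h = fun i => ∑ j, a c i j • τ c (h j) := rfl

/-- **`F_a(τ) = #(twist)^Δ`**: the fixed-vector count is the number of invariants of the matrix twist.
[cite: MilneADT2006, I §5 (proof of Thm. 5.1)] -/
theorem natCard_fixedVectors_eq_invariants {V : Type} [AddCommGroup V] (τ : Representation ℤ Δ V)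
    (h1) (hmul) :
    Nat.card {h : Fin d → V // ∀ c : Δ, (fun i => ∑ j, a c i j • τ c (h j)) = h} =
      Nat.card (Representation.invariants (twistRep a τ h1 hmul)) :=
  Nat.card_congr (Equiv.subtypeEquivRight fun _ => Iff.rfl)

/-- A componentwise map intertwines the matrix twists.
[cite: MilneADT2006, I §5 (proof of Thm. 5.1)] -/
theorem compLeft_twistRep {V V' : Type} [AddCommGroup V] [AddCommGroup V'] (τ : Representation ℤ Δ V)
    (τ' : Representation ℤ Δ V') (h1 hmul h1' hmul') (f : V →ₗ[ℤ] V')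
    (hf : ∀ s x, f (τ s x) = τ' s (f x)) (c : Δ) (h : Fin d → V) :
    f.compLeft (Fin d) (twistRep a τ h1 hmul c h) = twistRep a τ' h1' hmul' c (f.compLeft (Fin d) h) := by
  funext i
  simp only [LinearMap.compLeft_apply, Function.comp_apply, twistRep_apply, map_sum, map_zsmul, hf]

/-- **(E2a-2) `v_p F_a` is additive on short exact sequences of finite `ℤ[Δ]`-modules killed by `p`**
(`p ∤ #Δ`; `a` any integer matrix family satisfying the unit / multiplicativity relations on every
`p`-torsion module — e.g. `coordMatrix σ bv`).  This is the additivity hypothesis `hψ` of the lane's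
additive calculus for `ψ(τ) := v_p F_a(τ)`, instance-polymorphic in `Module ℤ`.
[cite: MilneADT2006, I §5 (proof of Thm. 5.1)] [cite: SerreLinearRepresentations1977, §15.5] -/
theorem additive_padicValNat_fixedVectors [Fintype Δ] (hΔ : ¬ p ∣ Fintype.card Δ)
    (h1 : ∀ ⦃X : Type⦄ [AddCommGroup X] [Module ℤ X], (∀ x : X, (p : ℤ) • x = 0) →
      ∀ x : Fin d → X, (fun i => ∑ j, a 1 i j • x j) = x)
    (hmul : ∀ ⦃X : Type⦄ [AddCommGroup X] [Module ℤ X], (∀ x : X, (p : ℤ) • x = 0) →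
      ∀ (c c' : Δ) (x : Fin d → X),
        (fun i => ∑ j, a (c * c') i j • x j) = fun i => ∑ j, a c i j • ∑ k, a c' j k • x k) :
    ∀ ⦃X Y Z : Type⦄ [AddCommGroup X] [Module ℤ X] [AddCommGroup Y] [Module ℤ Y]
      [AddCommGroup Z] [Module ℤ Z] (ρX : Representation ℤ Δ X) (ρY : Representation ℤ Δ Y)
      (ρZ : Representation ℤ Δ Z) (f : X →ₗ[ℤ] Y) (g : Y →ₗ[ℤ] Z),
      (∀ s x, f (ρX s x) = ρY s (f x)) → (∀ s y, g (ρY s y) = ρZ s (g y)) →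
      Injective f → Surjective g → LinearMap.range f = LinearMap.ker g → Finite Y →
      (∀ y : Y, (p : ℤ) • y = 0) →
      (padicValNat p (Nat.card {h : Fin d → Y // ∀ c : Δ, (fun i => ∑ j, a c i j • ρY c (h j)) = h}) : ℤ) =
        (padicValNat p (Nat.card {h : Fin d → X // ∀ c : Δ, (fun i => ∑ j, a c i j • ρX c (h j)) = h}) : ℤ) +
        (padicValNat p (Nat.card {h : Fin d → Z // ∀ c : Δ, (fun i => ∑ j, a c i j • ρZ c (h j)) = h}) : ℤ) := by
  intro X Y Z instXa instX instYa instY instZa instZ ρX ρY ρZ f g hf hg hfi hgs hex hfin hpY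
  cases Subsingleton.elim instX (AddCommGroup.toIntModule X)
  cases Subsingleton.elim instY (AddCommGroup.toIntModule Y)
  cases Subsingleton.elim instZ (AddCommGroup.toIntModule Z)
  have hpX : ∀ x : X, (p : ℤ) • x = 0 := fun x => hfi (by rw [map_zsmul, hpY, map_zero])
  have hpZ : ∀ z : Z, (p : ℤ) • z = 0 := fun z => by
    obtain ⟨y, rfl⟩ := hgs z
    rw [← map_zsmul, hpY, map_zero]
  -- the three twists and the componentwise maps
  let TX := twistRep a ρX (h1 hpX) (hmul hpX)
  let TY := twistRep a ρY (h1 hpY) (hmul hpY)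
  let TZ := twistRep a ρZ (h1 hpZ) (hmul hpZ)
  have hF : ∀ s h, f.compLeft (Fin d) (TX s h) = TY s (f.compLeft (Fin d) h) :=
    compLeft_twistRep a ρX ρY _ _ _ _ f hf
  have hG : ∀ s h, g.compLeft (Fin d) (TY s h) = TZ s (g.compLeft (Fin d) h) :=
    compLeft_twistRep a ρY ρZ _ _ _ _ g hg
  have hFi : Injective (f.compLeft (Fin d)) := fun h h' hh =>
    funext fun i => hfi (congrFun hh i)
  have hGs : Surjective (g.compLeft (Fin d)) := fun h =>
    ⟨fun i => (hgs (h i)).choose, funext fun i => (hgs (h i)).choose_spec⟩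
  have hEx : LinearMap.range (f.compLeft (Fin d)) = LinearMap.ker (g.compLeft (Fin d)) := by
    ext h
    rw [LinearMap.mem_range, LinearMap.mem_ker]
    constructor
    · rintro ⟨h', rfl⟩
      funext i
      have : f (h' i) ∈ LinearMap.ker g := hex ▸ LinearMap.mem_range_self f (h' i)
      exact this
    · intro hh
      have hi : ∀ i, h i ∈ LinearMap.range f := fun i => by
        rw [hex, LinearMap.mem_ker]
        exact congrFun hh i
      exact ⟨fun i => (hi i).choose, funext fun i => (hi i).choose_spec⟩
  haveI : Finite Y := hfin
  have hpY' : ∀ h : Fin d → Y, (p : ℤ) • h = 0 := fun h => funext fun i => by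
    rw [Pi.smul_apply, hpY, Pi.zero_apply]
  have key := InvariantsPrimeToP.additive_padicValNat_card_invariants (p := p) hΔ TX TY TZ
    (f.compLeft (Fin d)) (g.compLeft (Fin d)) hF hG hFi hGs hEx inferInstance hpY'
  rw [natCard_fixedVectors_eq_invariants a ρX (h1 hpX) (hmul hpX),
    natCard_fixedVectors_eq_invariants a ρY (h1 hpY) (hmul hpY),
    natCard_fixedVectors_eq_invariants a ρZ (h1 hpZ) (hmul hpZ)]
  exact key

end Twist

/-! ### (E2a-3) The regular value `F_{coordMatrix σ bv}(ℤ[Δ]/p) = #M′` -/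

/-- **`F_{coordMatrix σ bv}(ℤ[Δ]/p) = #M′`**: the fixed vectors of the coordinate twist of the regular
permutation module mod `p` (`Representation.permQuot Δ p` of the lane =
`(ofMulAction ℤ Δ Δ).quotient (p • ⊤)`) are counted by `M′`.
[cite: MilneADT2006, I §5 (proof of Thm. 5.1: `θ([M][𝔽_p[Ḡ]]) = #M`)] -/
theorem natCard_fixedVectors_permQuot [Fintype Δ] [DecidableEq Δ] {M' : Type} [AddCommGroup M'] [Module (ZMod p) M']
    [Finite M'] (σ : Representation ℤ Δ M') (bv : Module.Basis (Fin d) (ZMod p) M') :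
    Nat.card {h : Fin d → (MonoidAlgebra ℤ Δ ⧸ ((p : ℤ) • ⊤ : Submodule ℤ (MonoidAlgebra ℤ Δ))) //
        ∀ c : Δ, (fun i => ∑ j, coordMatrix σ bv c i j •
          ((Representation.ofMulAction ℤ Δ Δ).quotient ((p : ℤ) • ⊤)
            (StableLatticeReduction.smul_top_le_comap _ (p : ℤ))) c (h j)) = h} =
      Nat.card M' := by
  have hM' : ∀ m : M', (p : ℤ) • m = 0 := fun m => by
    rw [← Int.cast_smul_eq_zsmul (ZMod p), Int.cast_natCast, ZMod.natCast_self, zero_smul]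
  refine Eq.trans ?_ (TensorCoordinates.natCard_invariants_regular_tprod σ hM')
  -- the two spellings of the `ℤ`-action on `ℤ[Δ]/p` (quotient-module action / `zsmul`) agree `rfl`
  exact TensorCoordinates.natCard_fixed_matAct_eq
    (StableLatticeReduction.Int.smul_quotient_smul_top_eq_zero (p : ℤ)) bv _ σ (coordMatrix σ bv)
    (coordMatrix_spec σ bv)

end MatrixTwist

end Literature.RepresentationTheory.FiniteGroups
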